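import Literature.Geometry.Riemannian.CurveTubeChristoffelData
import Literature.Geometry.Riemannian.AxisChristoffelForm
import Literature.Geometry.Riemannian.AxisChristoffelEllipsoidBound
import Literature.Geometry.Riemannian.ChristoffelOfDerivative
import HarnessLib

/-!
# The Christoffel symbols of the tube metric on the axis (Lee 2018, Prop. 5.26 (d); Weinstein's step (2))

Topic `Geometry/Riemannian`. Let `Φ` be the tube map of a curve `c` with a `g`-orthonormal
adapted frame `e` (`CurveTubeMap.lean`), and let `g_U` be a metric on an open set `U` of the
model space `V` whose components `G_U` agree, near an axis point `x₁ ε₀`, with the pulled-back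
form `G_v(u, w) = g(dΦ_v u, dΦ_v w)`. Then the Christoffel map of `(g_U, G_U)` at `x₁ ε₀` is the
Riesz form `B` of the second-order data `A(z, u) = D_z(dΦ u)` of the tube
(`CurveTubeChristoffelData.lean`, `ChristoffelOfDerivative.lean`):

* `christoffel_tube_axis` — **`Γ_{x₁ε₀}(Y)(X) = B X Y`**, `⟪B z u, w⟫ = g(A(z, u), e(x₁) w)`;
* `christoffel_tube_axis_self` — for a relatively parallel frame,
  **`Γ(X)(X) = X₁² κ - 2 X₁ ⟪κ, X'⟫ ε₀`** with `⟪κ, w⟫ = g(D_t c'(x₁), e(x₁) w)`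
  (`AxisChristoffelForm.rieszOfForm_self_eq`, the four cases of `CurveTubeSecondOrder.lean`);
* `abs_inner_christoffel_tube_axis_le` — hence, for a unit-speed curve of geodesic curvature
  `≤ K` and a gradient `α ε₀ + β p`, `p ⊥ ε₀`:
  **`|⟪α ε₀ + β p, Γ(X)(X)⟫| ≤ 2 K ‖X‖² ‖α ε₀ + β p‖`** (`AxisChristoffelEllipsoidBound.lean`) —
  the axis case of the Christoffel term in the second fundamental form of Weinstein's thin
  ellipsoid (Weinstein 1968, proof of the main theorem, step (2)).

## References

* J. M. Lee, *Introduction to Riemannian Manifolds*, 2nd ed. (2018), Prop. 5.26 (d), (e).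
  [cite: LeeRiemannianManifolds2018, Prop. 5.26]
* A. Weinstein, Ann. of Math. (2) 87 (1968), 29–41, proof of the main theorem, step (2).
  [cite: Weinstein1968]

Tags: [FermiCoordinates] [ChristoffelSymbols] [Weinstein1968]
-/

noncomputable section

open Bundle Set Filter Function InnerProductSpace TopologicalSpace
open scoped Manifold ContDiff Topology RealInnerProductSpace

namespace Literature.Geometry.Riemannian

open Literature.Geometry.Lorentzian
open Literature.Geometry.Lorentzian.OpensChart
open Literature.Geometry.Lorentzian.PseudoRiemannianMetric

variable {V : Type*} [NormedAddCommGroup V] [InnerProductSpace ℝ V] [FiniteDimensional ℝ V]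
  {E : Type*} [NormedAddCommGroup E] [NormedSpace ℝ E] {H : Type*} [TopologicalSpace H]
  {I : ModelWithCorners ℝ E H} {M : Type*} [TopologicalSpace M] [ChartedSpace H M]
  [IsManifold I ∞ M] [FiniteDimensional ℝ E] [CompleteSpace E] [T2Space M] [BoundarylessManifold I M]
  {n : ℕ∞ω} [Fact (1 ≤ n)]
  (g : PseudoRiemannianMetric I n E (TangentSpace I : M → Type _)) [g.HasLeviCivita]
  [CovariantDerivative.ContMDiffCovariantDerivative g.leviCivita 1]
  [CovariantDerivative.ContMDiffCovariantDerivative g.leviCivita ((⊤ : ℕ∞) : ℕ∞ω)]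
  {c : ℝ → M} {e : Π t : ℝ, V →L[ℝ] TangentSpace I (c t)} {ε₀ : V}
  {U : Opens V} {m : ℕ∞ω}
  (gU : PseudoRiemannianMetric 𝓘(ℝ, V) m V (TangentSpace 𝓘(ℝ, V) : U → Type _))
  (GU : V → V →L[ℝ] V →L[ℝ] ℝ)

omit [FiniteDimensional ℝ V] [FiniteDimensional ℝ E] [CompleteSpace E] [T2Space M]
  [BoundarylessManifold I M] [Fact (1 ≤ n)] [g.HasLeviCivita]
  [CovariantDerivative.ContMDiffCovariantDerivative g.leviCivita 1]
  [CovariantDerivative.ContMDiffCovariantDerivative g.leviCivita ((⊤ : ℕ∞) : ℕ∞ω)]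
  [InnerProductSpace ℝ V] in
/-- Transport of a value of `g` along an equality of base points. [folklore] -/
private theorem val_congr_pt {p p' : M} (h : p = p') (a b : E) : g.val p a b = g.val p' a b := by
  subst h
  rfl

/-- **The Christoffel map of the tube metric on the axis is the Riesz form of the second-order
data** (Lee 2018, Prop. 5.26 (d) in invariant form): if the components `G_U` of a metric `g_U`
on `U ∋ x = x₁ε₀` agree near `x₁ε₀` with `G_v(u, w) = g(dΦ_v u, dΦ_v w)` and are differentiable
at `x₁ε₀`, then `Γ_x(Y)(X) = B X Y` where `⟪B z u, w⟫ = g(A(z, u), e(x₁) w)`,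
`A(z, u) = D_s(dΦ_{x₁ε₀+sz} u)|₀`: the derivative of `G_U` at `x₁ε₀` has the compatible form
`∂_z G(u, w) = ⟪B z u, w⟫ + ⟪u, B z w⟫` (`hasDerivAt_val_mfderiv_tubeMap_axis`), `G_U(x₁ε₀) = ⟪·,·⟫`
(`val_mfderiv_tubeMap_axis`) and `B` is symmetric (`covariantDerivAlong_mfderiv_tubeMap_symm`), so
`christoffel_eq_of_fderiv_eq` applies. [cite: LeeRiemannianManifolds2018, Prop. 5.26 (d)] -/
theorem christoffel_tube_axis (hgc : IsGeodesicallyComplete g.leviCivita)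
    (hs : ContMDiff (𝓘(ℝ, ℝ).prod 𝓘(ℝ, V)) I.tangent ∞
      (fun q : ℝ × V ↦ (TotalSpace.mk' E (c q.1) (e q.1 q.2) : TangentBundle I M)))
    (hε₀ : ‖ε₀‖ = 1) (he₀ : ∀ t, e t ε₀ = (velocity I c t : E))
    (hiso : ∀ t (u w : V), g.val (c t) (e t u) (e t w) = ⟪u, w⟫)
    (x : U) (x₁ : ℝ) (hx : (x : V) = x₁ • ε₀) (hG : ∀ a b : V, gU.val x a b = GU (x : V) a b)
    (hGU : ∀ᶠ v in 𝓝 (x₁ • ε₀), ∀ u w : V, GU v u w =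
      g.val (expMap g.leviCivita (c ⟪ε₀, v⟫) (e ⟪ε₀, v⟫ (v - ⟪ε₀, v⟫ • ε₀)))
        (mfderiv 𝓘(ℝ, V) I (fun v : V ↦ expMap g.leviCivita (c ⟪ε₀, v⟫)
          (e ⟪ε₀, v⟫ (v - ⟪ε₀, v⟫ • ε₀))) v u)
        (mfderiv 𝓘(ℝ, V) I (fun v : V ↦ expMap g.leviCivita (c ⟪ε₀, v⟫)
          (e ⟪ε₀, v⟫ (v - ⟪ε₀, v⟫ • ε₀))) v w))
    (hGUd : DifferentiableAt ℝ GU (x₁ • ε₀)) (Y X : V) :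
    haveI : CompleteSpace V := FiniteDimensional.complete ℝ V
    christoffel gU GU x Y X =
      (toDual ℝ V).symm ((g.val (c x₁) (covariantDerivAlong g.leviCivita
        (fun s : ℝ ↦ expMap g.leviCivita (c ⟪ε₀, x₁ • ε₀ + s • X⟫)
          (e ⟪ε₀, x₁ • ε₀ + s • X⟫ (x₁ • ε₀ + s • X - ⟪ε₀, x₁ • ε₀ + s • X⟫ • ε₀)))
        (fun s : ℝ ↦ mfderiv 𝓘(ℝ, V) I (fun v : V ↦ expMap g.leviCivita (c ⟪ε₀, v⟫)
          (e ⟪ε₀, v⟫ (v - ⟪ε₀, v⟫ • ε₀))) (x₁ • ε₀ + s • X) Y) 0)).comp (e x₁)) := by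
  haveI : CompleteSpace V := FiniteDimensional.complete ℝ V
  have hLC := isLeviCivita_leviCivita_holds (g := g)
  have htors : g.leviCivita.torsion = 0 := hLC.1
  set Φ : V → M := fun v : V ↦ expMap g.leviCivita (c ⟪ε₀, v⟫) (e ⟪ε₀, v⟫ (v - ⟪ε₀, v⟫ • ε₀))
    with hΦ
  -- the second-order data and its Riesz form
  set A : V → V → TangentSpace I (c x₁) := fun z u ↦ covariantDerivAlong g.leviCivita
    (fun s : ℝ ↦ Φ (x₁ • ε₀ + s • z)) (fun s : ℝ ↦ mfderiv 𝓘(ℝ, V) I Φ (x₁ • ε₀ + s • z) u) 0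
    with hA
  set B : V → V → V := fun z u ↦ (toDual ℝ V).symm ((g.val (c x₁) (A z u)).comp (e x₁)) with hB
  have hBinner : ∀ z u w, ⟪B z u, w⟫ = g.val (c x₁) (A z u) (e x₁ w) := fun z u w ↦ by
    simp only [hB, toDual_symm_apply]
    rfl
  have hAsymm : ∀ z u, A z u = A u z := fun z u ↦
    covariantDerivAlong_mfderiv_tubeMap_symm (cov := g.leviCivita) (ε₀ := ε₀) htors hgc hs
      (x₁ • ε₀) z u
  have hBsymm : ∀ z u, B z u = B u z := fun z u ↦ by simp only [hB, hAsymm]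
  -- the metric at the axis point is the inner product
  have hax : Φ (x₁ • ε₀) = c x₁ := tubeMap_axis (cov := g.leviCivita) (e := e) hε₀ x₁
  have hGx : ∀ a b : V, GU (x₁ • ε₀) a b = ⟪a, b⟫ := by
    intro a b
    rw [hGU.self_of_nhds a b, val_congr_pt g hax]
    exact val_mfderiv_tubeMap_axis (c := c) (e := e) g hgc hs hε₀ he₀ hiso x₁ a b
  have hgUx : ∀ a b : V, gU.val x a b = ⟪a, b⟫ := fun a b ↦ by rw [hG, hx, hGx]
  -- the derivative of the components at the axis point
  have hfd : ∀ z u w : V, fderiv ℝ GU (x₁ • ε₀) z u w = ⟪B z u, w⟫ + ⟪u, B z w⟫ := by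
    intro z u w
    -- along the line `s ↦ x₁ε₀ + sz`
    have hline : HasDerivAt (fun s : ℝ ↦ x₁ • ε₀ + s • z) z 0 := by
      simpa using ((hasDerivAt_id (0 : ℝ)).smul_const z).const_add (x₁ • ε₀)
    have h2 : HasDerivAt (fun s : ℝ ↦ GU (x₁ • ε₀ + s • z) u w) (fderiv ℝ GU (x₁ • ε₀) z u w) 0 := by
      have hsc : DifferentiableAt ℝ (fun y ↦ GU y u w) (x₁ • ε₀) := differentiableAt_apply₂ GU hGUd u w
      have h := hsc.hasFDerivAt.comp_hasDerivAt_of_eq (0 : ℝ) hline (by simp)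
      rw [fderiv_apply₂ GU hGUd u w z] at h
      exact h
    -- the same function, through the tube
    have h4 := hasDerivAt_val_mfderiv_tubeMap_axis (c := c) (e := e) (ε₀ := ε₀) g hgc hs hε₀ he₀
      x₁ z u w
    have hev : (fun s : ℝ ↦ GU (x₁ • ε₀ + s • z) u w) =ᶠ[𝓝 0] fun s : ℝ ↦
        g.val (Φ (x₁ • ε₀ + s • z)) (mfderiv 𝓘(ℝ, V) I Φ (x₁ • ε₀ + s • z) u)
          (mfderiv 𝓘(ℝ, V) I Φ (x₁ • ε₀ + s • z) w) := by
      have hc0 : Tendsto (fun s : ℝ ↦ x₁ • ε₀ + s • z) (𝓝 0) (𝓝 (x₁ • ε₀)) := by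
        have := hline.continuousAt.tendsto
        simpa using this
      filter_upwards [hc0.eventually hGU] with s hs'
      exact hs' u w
    have h5 := h4.congr_of_eventuallyEq hev
    exact h2.unique h5
  -- conclude with `christoffel_eq_of_fderiv_eq`
  have hD : ∀ z u w : V, fderiv ℝ GU x z u w = gU.val x (B z u) w + gU.val x u (B z w) := by
    intro z u w
    rw [hx, hfd, hgUx, hgUx]
  exact christoffel_eq_of_fderiv_eq x hBsymm hD Y X

/-- **`Γ(X)(X)` on the axis for a relatively parallel frame**: under the hypotheses of
`christoffel_tube_axis` for a smooth metric, if the frame is relatively parallel along `c`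
(`D_t(e u) = -g(e u, D_t c') c'` for `u ⊥ ε₀`), then
`Γ_x(X)(X) = ⟪ε₀, X⟫² κ - (2 ⟪ε₀, X⟫ ⟪κ, X - ⟪ε₀, X⟫ε₀⟫) ε₀` where
`⟪κ, w⟫ = g(D_t c'(x₁), e(x₁) w)` (`rieszOfForm_self_eq` with the four cases of
`CurveTubeSecondOrder.lean`). [cite: Weinstein1968, proof of the main theorem, step (2)] -/
theorem christoffel_tube_axis_self (hn : (∞ : ℕ∞ω) ≤ n) (hgc : IsGeodesicallyComplete g.leviCivita)
    (hs : ContMDiff (𝓘(ℝ, ℝ).prod 𝓘(ℝ, V)) I.tangent ∞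
      (fun q : ℝ × V ↦ (TotalSpace.mk' E (c q.1) (e q.1 q.2) : TangentBundle I M)))
    (hε₀ : ‖ε₀‖ = 1) (he₀ : ∀ t, e t ε₀ = (velocity I c t : E))
    (hiso : ∀ t (u w : V), g.val (c t) (e t u) (e t w) = ⟪u, w⟫)
    (hpar : ∀ t (u : V), ⟪ε₀, u⟫ = 0 → covariantDerivAlong g.leviCivita c (fun t ↦ e t u) t =
      -(g.val (c t) (e t u) (covariantDerivAlong g.leviCivita c (fun t ↦ velocity I c t) t)) •
        (velocity I c t))
    (x : U) (x₁ : ℝ) (hx : (x : V) = x₁ • ε₀) (hG : ∀ a b : V, gU.val x a b = GU (x : V) a b)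
    (hGU : ∀ᶠ v in 𝓝 (x₁ • ε₀), ∀ u w : V, GU v u w =
      g.val (expMap g.leviCivita (c ⟪ε₀, v⟫) (e ⟪ε₀, v⟫ (v - ⟪ε₀, v⟫ • ε₀)))
        (mfderiv 𝓘(ℝ, V) I (fun v : V ↦ expMap g.leviCivita (c ⟪ε₀, v⟫)
          (e ⟪ε₀, v⟫ (v - ⟪ε₀, v⟫ • ε₀))) v u)
        (mfderiv 𝓘(ℝ, V) I (fun v : V ↦ expMap g.leviCivita (c ⟪ε₀, v⟫)
          (e ⟪ε₀, v⟫ (v - ⟪ε₀, v⟫ • ε₀))) v w))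
    (hGUd : DifferentiableAt ℝ GU (x₁ • ε₀)) (X : V) :
    haveI : CompleteSpace V := FiniteDimensional.complete ℝ V
    christoffel gU GU x X X =
      ⟪ε₀, X⟫ ^ 2 • (toDual ℝ V).symm ((g.val (c x₁)
          (covariantDerivAlong g.leviCivita c (fun t ↦ velocity I c t) x₁)).comp (e x₁)) -
        (2 * ⟪ε₀, X⟫ * ⟪(toDual ℝ V).symm ((g.val (c x₁)
          (covariantDerivAlong g.leviCivita c (fun t ↦ velocity I c t) x₁)).comp (e x₁)),
            X - ⟪ε₀, X⟫ • ε₀⟫) • ε₀ := by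
  haveI : CompleteSpace V := FiniteDimensional.complete ℝ V
  have hLC := isLeviCivita_leviCivita_holds (g := g)
  have htors : g.leviCivita.torsion = 0 := hLC.1
  have hcov₁ : g.leviCivita.IsLocallyContMDiff 1 :=
    g.isLocallyContMDiff_leviCivita_holds 1 (le_trans (by exact_mod_cast le_top) hn)
  have hcov : g.leviCivita.IsLocallyContMDiff ∞ :=
    g.isLocallyContMDiff_leviCivita_holds ⊤ (le_trans (by exact_mod_cast le_rfl) hn)
  set Φ : V → M := fun v : V ↦ expMap g.leviCivita (c ⟪ε₀, v⟫) (e ⟪ε₀, v⟫ (v - ⟪ε₀, v⟫ • ε₀))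
    with hΦ
  -- the second-order data as a function of two vectors
  set A : V → V → TangentSpace I (c x₁) := fun z u ↦ covariantDerivAlong g.leviCivita
    (fun s : ℝ ↦ Φ (x₁ • ε₀ + s • z)) (fun s : ℝ ↦ mfderiv 𝓘(ℝ, V) I Φ (x₁ • ε₀ + s • z) u) 0
    with hA
  set acc : TangentSpace I (c x₁) := covariantDerivAlong g.leviCivita c (fun t ↦ velocity I c t) x₁
    with hacc_def
  -- step 1: the Christoffel map is `B`
  have h1 := christoffel_tube_axis (c := c) (e := e) (ε₀ := ε₀) g gU GU hgc hs hε₀ he₀ hiso x x₁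
    hx hG hGU hGUd X X
  rw [h1]
  -- step 2: the hypotheses of `rieszOfForm_self_eq`
  have hAsymm : ∀ z u, A z u = A u z := fun z u ↦
    covariantDerivAlong_mfderiv_tubeMap_symm (cov := g.leviCivita) (ε₀ := ε₀) htors hgc hs
      (x₁ • ε₀) z u
  have hAadd : ∀ z u u', A z (u + u') = A z u + A z u' := fun z u u' ↦
    covariantDerivAlong_mfderiv_tubeMap_add (cov := g.leviCivita) (ε₀ := ε₀) hgc hs (x₁ • ε₀) z u u'
  have hAsmul : ∀ z u (t : ℝ), A z (t • u) = t • A z u := fun z u t ↦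
    covariantDerivAlong_mfderiv_tubeMap_smul (cov := g.leviCivita) (ε₀ := ε₀) hgc hs (x₁ • ε₀) z u t
  have hacc : A ε₀ ε₀ = acc :=
    covariantDerivAlong_mfderiv_tubeMap_axis_unit_unit (cov := g.leviCivita) hgc hs hε₀ x₁
  have hpar' : ∀ u : V, ⟪ε₀, u⟫ = 0 → A ε₀ u = -(g.val (c x₁) (e x₁ u) acc) • e x₁ ε₀ := by
    intro u hu
    have h := covariantDerivAlong_mfderiv_tubeMap_axis_unit_normal (cov := g.leviCivita) hgc hs
      hε₀ x₁ hu
    have h2 : A ε₀ u = covariantDerivAlong g.leviCivita c (fun t ↦ e t u) x₁ := h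
    rw [h2, hpar x₁ u hu, he₀ x₁]
  have hnn : ∀ u u' : V, ⟪ε₀, u⟫ = 0 → ⟪ε₀, u'⟫ = 0 → A u u' = 0 := fun u u' hu hu' ↦
    covariantDerivAlong_mfderiv_tubeMap_axis_normal_normal (cov := g.leviCivita) hcov₁ hcov htors
      hgc hs hε₀ x₁ hu hu'
  have key := rieszOfForm_self_eq (T := E) (g.val (c x₁)) (e x₁) A hε₀ (g.symm (c x₁)) (hiso x₁)
    hAsymm hAadd hAsmul hacc hpar' hnn X
  rw [hacc] at key
  exact key

/-- **`|⟪α ε₀ + β p, Γ(X)(X)⟫| ≤ 2 K ‖X‖² ‖α ε₀ + β p‖` on the axis** — the Christoffel term of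
the Hessian of an ellipsoid function (gradient `α ε₀ + β p`, `p ⊥ ε₀`) for a Riemannian ambient
metric, a unit-speed curve with `g(D_t c', c') = 0` and `|D_t c'|²_g ≤ K²` at `x₁`, and a
relatively parallel orthonormal frame (`christoffel_tube_axis_self` and
`abs_inner_axisChristoffel_le`; `‖κ‖² = g(D_t c', e κ) ≤ |D_t c'|_g ‖κ‖`).
[cite: Weinstein1968, proof of the main theorem, step (2)] -/
theorem abs_inner_christoffel_tube_axis_le (hn : (∞ : ℕ∞ω) ≤ n) (hg : g.IsRiemannian)
    (hgc : IsGeodesicallyComplete g.leviCivita)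
    (hs : ContMDiff (𝓘(ℝ, ℝ).prod 𝓘(ℝ, V)) I.tangent ∞
      (fun q : ℝ × V ↦ (TotalSpace.mk' E (c q.1) (e q.1 q.2) : TangentBundle I M)))
    (hε₀ : ‖ε₀‖ = 1) (he₀ : ∀ t, e t ε₀ = (velocity I c t : E))
    (hiso : ∀ t (u w : V), g.val (c t) (e t u) (e t w) = ⟪u, w⟫)
    (hpar : ∀ t (u : V), ⟪ε₀, u⟫ = 0 → covariantDerivAlong g.leviCivita c (fun t ↦ e t u) t =
      -(g.val (c t) (e t u) (covariantDerivAlong g.leviCivita c (fun t ↦ velocity I c t) t)) •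
        (velocity I c t))
    (x : U) (x₁ : ℝ) (hx : (x : V) = x₁ • ε₀) (hG : ∀ a b : V, gU.val x a b = GU (x : V) a b)
    (hGU : ∀ᶠ v in 𝓝 (x₁ • ε₀), ∀ u w : V, GU v u w =
      g.val (expMap g.leviCivita (c ⟪ε₀, v⟫) (e ⟪ε₀, v⟫ (v - ⟪ε₀, v⟫ • ε₀)))
        (mfderiv 𝓘(ℝ, V) I (fun v : V ↦ expMap g.leviCivita (c ⟪ε₀, v⟫)
          (e ⟪ε₀, v⟫ (v - ⟪ε₀, v⟫ • ε₀))) v u)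
        (mfderiv 𝓘(ℝ, V) I (fun v : V ↦ expMap g.leviCivita (c ⟪ε₀, v⟫)
          (e ⟪ε₀, v⟫ (v - ⟪ε₀, v⟫ • ε₀))) v w))
    (hGUd : DifferentiableAt ℝ GU (x₁ • ε₀))
    {K : ℝ} (hK : 0 ≤ K)
    (hcurv : g.val (c x₁) (covariantDerivAlong g.leviCivita c (fun t ↦ velocity I c t) x₁)
      (covariantDerivAlong g.leviCivita c (fun t ↦ velocity I c t) x₁) ≤ K ^ 2)
    (hgeod : g.val (c x₁) (covariantDerivAlong g.leviCivita c (fun t ↦ velocity I c t) x₁)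
      (velocity I c x₁) = 0)
    {p : V} (hp : ⟪ε₀, p⟫ = 0) (α β : ℝ) (X : V) :
    |⟪α • ε₀ + β • p, christoffel gU GU x X X⟫| ≤ 2 * K * ‖X‖ ^ 2 * ‖α • ε₀ + β • p‖ := by
  haveI : CompleteSpace V := FiniteDimensional.complete ℝ V
  rw [christoffel_tube_axis_self (c := c) (e := e) (ε₀ := ε₀) g gU GU hn hgc hs hε₀ he₀ hiso hpar x
    x₁ hx hG hGU hGUd X]
  set acc : TangentSpace I (c x₁) := covariantDerivAlong g.leviCivita c (fun t ↦ velocity I c t) x₁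
    with hacc_def
  set κ : V := (toDual ℝ V).symm ((g.val (c x₁) acc).comp (e x₁)) with hκ
  have hκinner : ∀ w : V, ⟪κ, w⟫ = g.val (c x₁) acc (e x₁ w) := fun w ↦ by
    rw [hκ, toDual_symm_apply]
    rfl
  -- `κ ⊥ ε₀` and `‖κ‖ ≤ K`
  have hκperp : ⟪ε₀, κ⟫ = 0 := by
    rw [real_inner_comm, hκinner, he₀ x₁]
    exact hgeod
  have hκnorm : ‖κ‖ ≤ K := by
    have h1 : ‖κ‖ ^ 2 = g.val (c x₁) acc (e x₁ κ) := by
      rw [← real_inner_self_eq_norm_sq, hκinner]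
    -- `0 ≤ g(acc - e κ, acc - e κ) = g(acc, acc) - ‖κ‖²`
    have h2 : 0 ≤ g.val (c x₁) (acc - e x₁ κ) (acc - e x₁ κ) := by
      by_cases h0 : acc - e x₁ κ = 0
      · rw [h0]; simp
      · exact (hg _ _ h0).le
    have h3 : g.val (c x₁) (acc - e x₁ κ) (acc - e x₁ κ) =
        g.val (c x₁) acc acc - 2 * g.val (c x₁) acc (e x₁ κ) + g.val (c x₁) (e x₁ κ) (e x₁ κ) := by
      rw [(g.val (c x₁)).map_sub₂, map_sub, map_sub, g.symm (c x₁) (e x₁ κ) acc]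
      ring
    rw [h3, hiso, real_inner_self_eq_norm_sq, ← h1] at h2
    have h4 : ‖κ‖ ^ 2 ≤ K ^ 2 := by linarith
    exact (pow_le_pow_iff_left₀ (norm_nonneg κ) hK two_ne_zero).1 h4
  exact abs_inner_axisChristoffel_le hε₀ hp hκperp hκnorm α β X

end Literature.Geometry.Riemannian

end
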